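import Summits.CriticalPhenomena.PercolationContinuityZ3.Theorems.Transplant.SkeletonFrmQuasiCustomersHolds
import Summits.CriticalPhenomena.PercolationContinuityZ3.Theorems.Transplant.StepGraphInstances
import HarnessLib

/-!
# Every connected, locally finite, TRANSLATION-INVARIANT graph on `ℤ^d` (`d ≥ 2`) has `p_c < 1` and dies at its own critical point;
# LADDER rung R1a (`stepGraph d S`, every `d ≥ 2`, every admissible step set) unconditionally

builds on p205010 (kernel theorem, internal audit signed; external expert review pending).  Lane `prim-bschramm`, seat `prim-bschramm-stmt`
gen 36 (statements seat; by-name customer of the rung-Q node); helper file (`--supports stmt-CriticalPhenomena-4575 --as helper`); PROOFS ONLY (def-free).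

THE POINT.  A graph `G` on the vertex type `Site d = ℤ^d` which is TRANSLATION INVARIANT (`G.Adj (x + v) (y + v) ↔ G.Adj x y`, the hypothesis `hT`
of the lane's `TransInv` toolkit, «TranslationInvariantStrictSlab» / «TranslationInvariantAmenable») carries the regular action of `ℤ^d` (Mathlib's
`Multiplicative (Site d)` acting on `Site d` by `a • x = a + x`): by automorphisms, FREE, with ONE orbit.  So the rung-Q node («SkelFrmQuasiProxHoldsAll»,
p553137) through «SkeletonFrmQuasiCustomersHolds» §`AutChart.conj4_zdPeriodic_holds` gives, for `d ≥ 2`, `G` connected and locally finite, at EVERY vertex: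
**`p_c(x) < 1` and `θ_x(p_c(x)) = 0`** — `TransInv.conj4_holds`.  NO range bound (long-range locally finite bond sets included), NO `p_c < 1` input, NO
same-`p` slab hypothesis: this is the hypothesis-free form of the toolkit's conditional rung `TransInv.theta_ownCritical_eq_zero_of_samePSlab (hT) (hR) (hconn)
(hpc) (hsame)`.  INSTANCES: the step graphs `stepGraph d S` of interface (I-a) («StepGraphDefs»: `x ∼ y ⟺ y − x ∈ ±S`; translation invariant by
`stepGraph_adj_add_right`) — for EVERY finite `S` making the graph connected (`stepGraph_conj4_holds_of_connected`), in particular for every ADMISSIBLE step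
set (`stepGraph_connected`): **`stepGraph_conj4_holds`, `stepGraph_theta_ownCritical_eq_zero (hd : 2 ≤ d) (hS : AdmissibleSteps d S)`** — LADDER rung R1a
(`run/shared/lean/prim/bschramm/LADDER.md` §R1a: `ℤ^d` with an `HOct`-invariant range-1 step set, the symmetric finite-range cubic lattices) for EVERY `d ≥ 2`,
superseding by their own conclusion the conditional rung theorems `stepGraph_theta_ownCritical_eq_zero_of_samePSlab / _of_samePWitness` («StepGraphInstances»).
The `d = 3` members (18-, 14-, 26-neighbour cubic lattices) were already closed by `Z3Shell.shell_criticalContinuity_holds`; `S = unitSteps d` is `ℤ^d` itself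
(p205010).  Nothing is claimed at `ℤ^d`'s nearest-neighbour critical point for an enlarged graph (own critical points only), nor about Conj. 4 beyond these
periodic instances.
[cite: BenjaminiSchramm1996, Conj. 4; §2 (almost transitive graphs)] [cite: Kesten1982, Ch. 3 (periodic graphs)] [cite: KozmaNitzan2024, Thm. 6 (p. 15)]
[cite: GrimmettPercolation1999, §1.4 (1.11); §7.2 p. 148]
-/

noncomputable section

namespace Summit.CriticalPhenomena.PercolationContinuityZ3.Theorems

namespace Transplant

open SimpleGraph Literature.Barriers.CriticalPhenomena Literature.Probability.LatticeModels Literature.Probability.Percolation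
open scoped Classical

namespace TransInv

variable {d : ℕ} (G : SimpleGraph (Site d))

/-- **Every connected, locally finite, translation-invariant graph on `ℤ^d`, `d ≥ 2`, has `p_c < 1` and `θ_x(p_c) = 0` at every vertex** — from the
rung-Q node via `AutChart.conj4_zdPeriodic_holds`: `ℤ^d` acts on `G` by translations (Mathlib's action of `Multiplicative (Site d)` on `Site d`,
`a • x = a + x`), by automorphisms (`hT`), freely, with the single orbit of `0`.  No range bound, no `p_c < 1` input, no same-`p` slab hypothesis.
builds on p205010 (kernel theorem, internal audit signed; external expert review pending).
[cite: BenjaminiSchramm1996, Conj. 4; §2] [cite: Kesten1982, Ch. 3 (periodic graphs)] -/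
theorem conj4_holds (hd : 2 ≤ d) [G.LocallyFinite] (hT : ∀ v x y : Site d, G.Adj (x + v) (y + v) ↔ G.Adj x y) (hconn : G.Connected)
    (x : Site d) : criticalProb G x < 1 ∧ theta G x (criticalProbIOf G x) = 0 := by
  have hact : IsActionByAut G (Multiplicative (Site d)) := fun a y z => by
    change G.Adj (Multiplicative.toAdd a + y) (Multiplicative.toAdd a + z) ↔ G.Adj y z
    rw [add_comm _ y, add_comm _ z]
    exact hT _ y z
  have hfree : ∀ (a : Multiplicative (Site d)) (w : Site d), a • w = w → a = 1 := fun a w h => by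
    have h' : Multiplicative.toAdd a + w = w := h
    exact Multiplicative.toAdd.injective (by rw [toAdd_one]; exact add_eq_right.1 h')
  have hcover : ∀ w : Site d, ∃ a : Multiplicative (Site d), ∃ r ∈ ({0} : Finset (Site d)), a • r = w := fun w =>
    ⟨Multiplicative.ofAdd w, 0, Finset.mem_singleton_self _, by
      change Multiplicative.toAdd (Multiplicative.ofAdd w) + 0 = w
      rw [toAdd_ofAdd, add_zero]⟩
  exact AutChart.conj4_zdPeriodic_holds hd hact hfree hconn {0} hcover x

/-- **`θ_x(p_c) = 0` on every connected, locally finite, translation-invariant graph on `ℤ^d`, `d ≥ 2`** — the hypothesis-free form of the conditional rung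
`TransInv.theta_ownCritical_eq_zero_of_samePSlab`. builds on p205010 (kernel theorem, internal audit signed; external expert review pending).
[cite: BenjaminiSchramm1996, Conj. 4] [cite: KozmaNitzan2024, Thm. 6 (p. 15)] -/
theorem theta_ownCritical_eq_zero (hd : 2 ≤ d) [G.LocallyFinite] (hT : ∀ v x y : Site d, G.Adj (x + v) (y + v) ↔ G.Adj x y)
    (hconn : G.Connected) (x : Site d) : theta G x (criticalProbIOf G x) = 0 :=
  (conj4_holds G hd hT hconn x).2

/-- **`p_c(x) < 1` on every connected, locally finite, translation-invariant graph on `ℤ^d`, `d ≥ 2`**, at every vertex (projection character of the free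
`ℤ^d`-action; cf. the tree's `criticalProb_stepGraph_lt_one` for admissible step graphs). builds on p205010 (kernel theorem, internal audit signed;
external expert review pending) — only through the packaging in `conj4_zdPeriodic_holds`. [cite: BenjaminiSchramm1996, Thm. 1 / §2] -/
theorem criticalProb_lt_one (hd : 2 ≤ d) [G.LocallyFinite] (hT : ∀ v x y : Site d, G.Adj (x + v) (y + v) ↔ G.Adj x y)
    (hconn : G.Connected) (x : Site d) : criticalProb G x < 1 :=
  (conj4_holds G hd hT hconn x).1

end TransInv

/-! ## The step graphs of interface (I-a): LADDER rung R1a -/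

variable {d : ℕ}

/-- **Every CONNECTED step graph `stepGraph d S` (`d ≥ 2`, `S` any finite step set) has `p_c < 1` and dies at its own critical point at every vertex**
(translation invariance `stepGraph_adj_add_right`). builds on p205010 (kernel theorem, internal audit signed; external expert review pending).
[cite: BenjaminiSchramm1996, Conj. 4; §2] -/
theorem stepGraph_conj4_holds_of_connected (hd : 2 ≤ d) (S : Finset (Site d)) (hc : (stepGraph d S).Connected) (x : Site d) :
    criticalProb (stepGraph d S) x < 1 ∧ theta (stepGraph d S) x (criticalProbIOf (stepGraph d S) x) = 0 :=
  TransInv.conj4_holds (stepGraph d S) hd (stepGraph_adj_add_right S) hc x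

/-- **LADDER rung R1a, every `d ≥ 2`, every ADMISSIBLE step set, every vertex**: `p_c < 1 ∧ θ_x(p_c) = 0` on `stepGraph d S` (the symmetric
range-1 cubic lattices: for `d = 3` the 18-, 14-, 26-neighbour lattices, already closed by `Z3Shell.shell_criticalContinuity_holds`; `S = unitSteps d` is `ℤ^d`).
builds on p205010 (kernel theorem, internal audit signed; external expert review pending). [cite: BenjaminiSchramm1996, Conj. 4; §2]
[cite: KozmaNitzan2024, Thm. 6 (p. 15)] -/
theorem stepGraph_conj4_holds (hd : 2 ≤ d) {S : Finset (Site d)} (hS : AdmissibleSteps d S) (x : Site d) :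
    criticalProb (stepGraph d S) x < 1 ∧ theta (stepGraph d S) x (criticalProbIOf (stepGraph d S) x) = 0 :=
  stepGraph_conj4_holds_of_connected hd S (stepGraph_connected hS) x

/-- **Rung R1a in the LADDER's own wording — `θ_{stepGraph d S}(0, p_c) = 0`, every `d ≥ 2`, every admissible `S`, UNCONDITIONALLY**: the common conclusion
of «StepGraphInstances»' conditional rung theorems `stepGraph_theta_ownCritical_eq_zero_of_samePSlab` / `…_of_samePWitness`, with their hypotheses gone.
builds on p205010 (kernel theorem, internal audit signed; external expert review pending). [cite: KozmaNitzan2024, Thm. 6 (p. 15)]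
[cite: BenjaminiSchramm1996, Conj. 4] -/
theorem stepGraph_theta_ownCritical_eq_zero (hd : 2 ≤ d) {S : Finset (Site d)} (hS : AdmissibleSteps d S) :
    theta (stepGraph d S) 0 (criticalProbIOf (stepGraph d S) 0) = 0 :=
  (stepGraph_conj4_holds hd hS 0).2

end Transplant

end Summit.CriticalPhenomena.PercolationContinuityZ3.Theorems

end
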